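import Mathlib
import HarnessLib.Audit
import Summits.PneNP.PneNP.Theorems.PstarGapOneAll
import Summits.PneNP.PneNP.Theorems.PstarGapPeeling

/-!
# From the reader-graph induction to the single-query rung: `GSat → GapOneAll → PstarGapOne` (ROUND-24, item T24.17, wiring)

FRONTIER range-avoidance ladder, rung F-N3, ROUND 24 (cell `pnp-ideate`; restricted-model proof complexity — nothing here bears
on `P` versus `NP`).

`PstarGapOneAll.GSat` (T24.17′) is the induction statement of the planner's reader-graph argument (memo ROUND-24-PRESEED §13
R10(p)): every non-constant G-constraint is satisfiable together with any output set `J` of size `≤ r`.  This file records the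
bookkeeping that turns it into the rung statements:

* `gapOneAll_of_gSat : GSat → GapOneAll` — with at most ONE parity constraint no non-empty `J` (`|J| ≤ r`) is minimally infeasible.
  Cases: `W = ∅` is peeling (`PstarGapPeeling.feasible_of_boundaryExpanding`); `W = {(C, b)}` with `C ≠ ∅`: the plain parity of `C`
  is a non-constant G-constraint with `G = ∅` (`gval_empty`), so `GSat` makes `J ∪ W` feasible — no infeasible `J` at all; `C = ∅`,
  `b = false`: the constraint is vacuous, peeling again; `C = ∅`, `b = true`: the constraint alone is violated by every assignment, so
  no erasure `J ∖ {j}` is feasible either and a minimal infeasible `J` must be empty.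
* `pstarGapOne_of_gSat : GSat → PstarGapOne` (with `K = 0`, via `PstarGapOneAll.pstarGapOne_of_gapOneAll`).

So once `GSat` is a theorem of the tree, T24.17 and the rung T24.12 close by name with one-line proofs.
-/

set_option linter.dupNamespace false

open Finset Literature.Computability.Complexity
open Summit.PneNP.PneNP.Theorems.PstarTyped (Typed)
open Summit.PneNP.PneNP.Theorems.PstarSALevel (BoundaryExpanding SimpleOverlap)
open Summit.PneNP.PneNP.Theorems.PstarPDT (parity)
open Summit.PneNP.PneNP.Theorems.PstarGapLemma (Sat Feasible MinInfeasible)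
open Summit.PneNP.PneNP.Theorems.PstarGapOne (PstarGapOne)
open Summit.PneNP.PneNP.Theorems.PstarGapOneAll (GapOneAll GSat gval gval_empty pstarGapOne_of_gapOneAll)
open Summit.PneNP.PneNP.Theorems.PstarGapPeeling (feasible_of_boundaryExpanding)

namespace Summit.PneNP.PneNP.Theorems.PstarGapOneAllOfGSat

variable {n m : ℕ}

/-- The parity of the empty set is `false` at every assignment. -/
theorem parity_empty (z : Fin n → Bool) : parity (∅ : Finset (Fin n)) z = false := by
  simp [PstarPDT.parity]

/-- The parity of a non-empty set is not constant: it is `false` at the all-`false` assignment and `true` after switching on one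
member. -/
theorem parity_nonconst {C : Finset (Fin n)} (hC : C.Nonempty) :
    ∃ z z' : Fin n → Bool, parity C z ≠ parity C z' := by
  classical
  obtain ⟨v, hv⟩ := hC
  refine ⟨fun _ => false, Function.update (fun _ => false) v true, ?_⟩
  have h0 : (C.filter fun w => (fun _ : Fin n => false) w = true) = ∅ := by
    ext w; simp
  have h1 : (C.filter fun w => Function.update (fun _ : Fin n => false) v true w = true) = {v} := by
    ext w
    simp only [mem_filter, mem_singleton]
    constructor
    · rintro ⟨-, hw⟩
      by_contra hne
      rw [Function.update_of_ne hne] at hw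
      exact Bool.false_ne_true hw
    · rintro rfl
      exact ⟨hv, by rw [Function.update_self]⟩
  simp only [PstarPDT.parity, h0, h1, card_empty, card_singleton, ne_eq, decide_eq_decide]
  decide

/-- **T24.17 from T24.17′**: the reader-graph induction statement gives the single-query rung for every parity. -/
theorem gapOneAll_of_gSat (h : GSat) : GapOneAll := by
  classical
  intro n m r I hI hT hB hS y W J hW hJ hmin
  -- every `J` with `|J| ≤ r` is solvable with no constraint (peeling)
  have hpeel : ∀ J' : Finset (Fin m), J'.card ≤ r → ∃ z : Fin n → Bool, ∀ j ∈ J', I.eval z j = y j :=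
    feasible_of_boundaryExpanding I hI hB y
  rcases Nat.lt_or_ge W.card 1 with h0 | h1
  · -- `W = ∅`
    have hW0 : W = ∅ := card_eq_zero.1 (by omega)
    subst hW0
    obtain ⟨z, hz⟩ := hpeel J hJ
    exact absurd ⟨z, fun e he => absurd he (notMem_empty _), hz⟩ hmin.1
  · -- `W = {(C, b)}`
    have hW1 : W.card = 1 := le_antisymm hW h1
    obtain ⟨⟨C, b⟩, rfl⟩ := card_eq_one.1 hW1
    by_cases hC : C = ∅
    · subst hC
      cases b with
      | false =>
        -- the constraint `parity ∅ = false` is vacuous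
        obtain ⟨z, hz⟩ := hpeel J hJ
        refine absurd ⟨z, fun e he => ?_, hz⟩ hmin.1
        rw [mem_singleton] at he
        subst he
        exact parity_empty z
      | true =>
        -- the constraint `parity ∅ = true` is violated by every assignment: no erasure is feasible either
        refine eq_empty_of_forall_notMem fun j hj => ?_
        obtain ⟨z, hzW, -⟩ := hmin.2 j hj
        have := hzW (∅, true) (mem_singleton_self _)
        rw [parity_empty] at this
        exact Bool.false_ne_true this
    · -- `C ≠ ∅`: the parity of `C` is a non-constant G-constraint with `G = ∅`, so `GSat` makes `J ∪ W` feasible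
      have hne : C.Nonempty := nonempty_iff_ne_empty.2 hC
      have hnc : ∃ z z' : Fin n → Bool, gval I C ∅ z ≠ gval I C ∅ z' := by
        obtain ⟨z, z', hzz'⟩ := parity_nonconst hne
        exact ⟨z, z', by rwa [gval_empty, gval_empty]⟩
      obtain ⟨z, hzJ, hzg⟩ := h n m r I hI hT hB hS y J ∅ C b hJ (disjoint_empty_right J) hnc
      refine absurd ⟨z, fun e he => ?_, hzJ⟩ hmin.1
      rw [mem_singleton] at he
      subst he
      rwa [gval_empty] at hzg

/-- **T24.12 from T24.17′**: the reader-graph induction statement gives the single-query rung `PstarGapOne` (with `K = 0`). -/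
theorem pstarGapOne_of_gSat (h : GSat) : PstarGapOne :=
  pstarGapOne_of_gapOneAll (gapOneAll_of_gSat h)

end Summit.PneNP.PneNP.Theorems.PstarGapOneAllOfGSat
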